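import Summits.MatrixMultiplication.MatrixMultiplication.Theorems.SoloInformedValPairInequality

/-!
# The V-size inequality for coset classes

Setting of `SoloInformedValPairInequality`.  For two blocks `t ≠ u`, the set `V_u` contains
`Y_u + (X_t − Z_t) ⊇ X_t + (y_u − z_t) + (B + C)` whenever `B` is a period of `Y_u` and `C` a period of `Z_t`
(`y_u ∈ Y_u`, `z_t ∈ Z_t`).  If moreover `B` is a period of `Y_t − Z_t` (for pure subspace designs: `B_u ⊆ R_t`) —
and `C`, being a period of `Z_t`, always is — then the rows of `X_t` are incongruent modulo `B + C` and
`|X_t|·|B + C| ≤ |V_u|` (`card_mul_card_le_card_crossV`).  With the master packing inequality at `u` this is the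
V-SIZE INEQUALITY `|X_u||Y_u||Z_u| + |U_u| + |X_t|·|B + C| ≤ |G|` (`FamilyCriterionAt.vsize`,
`NoAccidental.vsize`): in a pure design with `B_u ⊆ R_t` one has `|V_u| ≥ |X_t||Y_t||Z_t|/2^{dim(B_u ∩ C_t)}`, which
forces `B_u ∩ C_t ≠ 0` once `2v + |U_u| > |G|` (dossier §15.8 (n)(xx ζ); the tournament lemma follows on paper).
-/

namespace Summit.MatrixMultiplication.MatrixMultiplication.Theorems.SoloVal

open Finset

section VSize

variable {G : Type*} [AddCommGroup G] [DecidableEq G]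
variable {ι : Type*} [DecidableEq ι] {T : Finset ι} {X Y Z : ι → Finset G} {t u : ι}

/-- `X_t + ((y_u − z_t) + (B + C)) ⊆ V_u` when `B` is a period of `Y_u` and `C` a period of `Z_t`. -/
theorem sumSet_translate_subset_crossV {B C : Finset G} (hC : ∀ r ∈ C, ∀ s ∈ C, r - s ∈ C)
    (hBY : ∀ y ∈ Y u, ∀ b ∈ B, y + b ∈ Y u) (hCZ : ∀ z ∈ Z t, ∀ c ∈ C, z + c ∈ Z t)
    (ht : t ∈ T) (htu : t ≠ u) {yu zt : G} (hyu : yu ∈ Y u) (hzt : zt ∈ Z t) :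
    sumSet (X t) ((sumSet B C).image fun r => (yu - zt) + r) ⊆ crossV T X Y Z u := by
  intro g hg
  obtain ⟨x, hx, d, hd, rfl⟩ := mem_sumSet.mp hg
  obtain ⟨r, hr, rfl⟩ := Finset.mem_image.mp hd
  obtain ⟨b, hb, c, hc, rfl⟩ := mem_sumSet.mp hr
  have hzc : zt + -c ∈ Z t := hCZ zt hzt (-c) (subClosed_neg_mem hC hc)
  exact mem_crossV.mpr ⟨yu + b, hBY yu hyu b hb, t, Finset.mem_erase.mpr ⟨htu, ht⟩, x, hx, zt + -c, hzc,
    by abel⟩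

omit [DecidableEq ι] in
/-- A period of `Z_t` (closed under subtraction) is a period of `Y_t − Z_t`. -/
theorem period_diffSet_of_period_right {C : Finset G} (hC : ∀ r ∈ C, ∀ s ∈ C, r - s ∈ C)
    (hCZ : ∀ z ∈ Z t, ∀ c ∈ C, z + c ∈ Z t) :
    ∀ d ∈ diffSet (Y t) (Z t), ∀ c ∈ C, d + c ∈ diffSet (Y t) (Z t) := by
  intro d hd c hc
  obtain ⟨y, hy, z, hz, rfl⟩ := mem_diffSet.mp hd
  have hzc : z + -c ∈ Z t := hCZ z hz (-c) (subClosed_neg_mem hC hc)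
  exact mem_diffSet.mpr ⟨y, hy, z + -c, hzc, by abel⟩

/-- The sum of two periods of a set is a period. -/
theorem period_sumSet {D B C : Finset G} (hB : ∀ d ∈ D, ∀ b ∈ B, d + b ∈ D)
    (hC : ∀ d ∈ D, ∀ c ∈ C, d + c ∈ D) : ∀ d ∈ D, ∀ r ∈ sumSet B C, d + r ∈ D := by
  intro d hd r hr
  obtain ⟨b, hb, c, hc, rfl⟩ := mem_sumSet.mp hr
  have h := hC (d + b) (hB d hd b hb) c hc
  rwa [add_assoc] at h

/-- `|X_t|·|B + C| ≤ |V_u|` when block `t` has the additive TPP with nonempty `Y_t`, `B` is a period of `Y_u` and of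
`Y_t − Z_t`, and `C` is a period of `Z_t`. -/
theorem card_mul_card_le_card_crossV {B C : Finset G} (hT : AddTPP (X t) (Y t) (Z t))
    (hC : ∀ r ∈ C, ∀ s ∈ C, r - s ∈ C)
    (hBY : ∀ y ∈ Y u, ∀ b ∈ B, y + b ∈ Y u) (hBD : ∀ d ∈ diffSet (Y t) (Z t), ∀ b ∈ B, d + b ∈ diffSet (Y t) (Z t))
    (hCZ : ∀ z ∈ Z t, ∀ c ∈ C, z + c ∈ Z t)
    (ht : t ∈ T) (htu : t ≠ u) {yt yu zt : G} (hyt : yt ∈ Y t) (hyu : yu ∈ Y u) (hzt : zt ∈ Z t) :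
    (X t).card * (sumSet B C).card ≤ (crossV T X Y Z u).card := by
  have hsat : ∀ d ∈ diffSet (Y t) (Z t), ∀ r ∈ sumSet B C, d + r ∈ diffSet (Y t) (Z t) :=
    period_sumSet hBD (period_diffSet_of_period_right hC hCZ)
  have hD : (diffSet (Y t) (Z t)).Nonempty := ⟨yt - zt, mem_diffSet.mpr ⟨yt, hyt, zt, hzt, rfl⟩⟩
  rw [← hT.card_sumSet_translate hsat hD (yu - zt)]
  exact Finset.card_le_card (sumSet_translate_subset_crossV hC hBY hCZ ht htu hyu hzt)

/-- V-SIZE INEQUALITY: `|X_u||Y_u||Z_u| + |U_u| + |X_t|·|B + C| ≤ |G|` under the family criterion at `u` and the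
additive TPP at `t`, for `B` a period of `Y_u` and of `Y_t − Z_t` and `C` a period of `Z_t`. -/
theorem FamilyCriterionAt.vsize [Fintype G] (hu : FamilyCriterionAt T X Y Z u) (hT : AddTPP (X t) (Y t) (Z t))
    {B C : Finset G} (hC : ∀ r ∈ C, ∀ s ∈ C, r - s ∈ C)
    (hBY : ∀ y ∈ Y u, ∀ b ∈ B, y + b ∈ Y u) (hBD : ∀ d ∈ diffSet (Y t) (Z t), ∀ b ∈ B, d + b ∈ diffSet (Y t) (Z t))
    (hCZ : ∀ z ∈ Z t, ∀ c ∈ C, z + c ∈ Z t)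
    (ht : t ∈ T) (htu : t ≠ u) {yt yu zt : G} (hyt : yt ∈ Y t) (hyu : yu ∈ Y u) (hzt : zt ∈ Z t) :
    (X u).card * (Y u).card * (Z u).card + (crossU T X Y Z u).card + (X t).card * (sumSet B C).card ≤
      Fintype.card G :=
  le_trans (Nat.add_le_add_left (card_mul_card_le_card_crossV hT hC hBY hBD hCZ ht htu hyt hyu hzt) _)
    hu.volume_add_card_crossU_add_card_crossV_le

/-- Accidental-free form of the V-size inequality. -/
theorem NoAccidental.vsize [Fintype G]
    (hY : ∀ b ∈ T, ∀ b' ∈ T, b ≠ b' → Disjoint (Y b) (Y b'))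
    (hZ : ∀ b ∈ T, ∀ b' ∈ T, b ≠ b' → Disjoint (Z b) (Z b'))
    (hN : NoAccidental (id : G → G) id id (famPairs T X Y) (famPairs T Y Z) (famPairs T Z X))
    {B C : Finset G} (hC : ∀ r ∈ C, ∀ s ∈ C, r - s ∈ C)
    (hBY : ∀ y ∈ Y u, ∀ b ∈ B, y + b ∈ Y u) (hBD : ∀ d ∈ diffSet (Y t) (Z t), ∀ b ∈ B, d + b ∈ diffSet (Y t) (Z t))
    (hCZ : ∀ z ∈ Z t, ∀ c ∈ C, z + c ∈ Z t)
    (ht : t ∈ T) (hu : u ∈ T) (htu : t ≠ u) {yt yu zt : G} (hyt : yt ∈ Y t) (hyu : yu ∈ Y u) (hzt : zt ∈ Z t) :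
    (X u).card * (Y u).card * (Z u).card + (crossU T X Y Z u).card + (X t).card * (sumSet B C).card ≤
      Fintype.card G :=
  (familyCriterion_of_noAccidental hY hZ hN hu).vsize (familyCriterion_of_noAccidental hY hZ hN ht).1 hC hBY
    hBD hCZ ht htu hyt hyu hzt

end VSize

end Summit.MatrixMultiplication.MatrixMultiplication.Theorems.SoloVal
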